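import Summits.AtomisticToContinuum.Crystallization.Theorems.ExcessDecayLiouvillePhononStabilityCertChainFast

/-!
# Near-certificate layer XII-c: ACCUMULATED chain charges (lead c2)

Support file for crux `PhononStability` (stmt-AtomisticToContinuum-9333), line `contragredient-window-collapse`.

The chain charges `chargePPF C qn qf` (one polynomial pair form per far class and chain step — far too many terms
to expand per cell) have, at the chart assignment, the same value as the 24-term form `chargeAccPPF tab C` built
from the accumulated table `tab = chainAcc qn qf` (per nearest-neighbour class `s`: `T0_s = Σ a_c ζ_cζ_cᵀ`,
`T1_s = Σ a_c s_c ζ_c`, `T2_s = Σ a_c s_c²`, `a_c = −U(Q_c)·|chain c|`, summed with multiplicity over the chains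
through `s`).  The table is cell independent: it is computed ONCE (natively) and supplied to every cell as a
literal.  `chargeAcc_le` transfers `charge_le`.
-/

noncomputable section

open scoped BigOperators Classical InnerProductSpace
open Filter Set Function
open Summit.AtomisticToContinuum.Crystallization.Theorems.PhononStabilityNegative
open Summit.AtomisticToContinuum.Crystallization.Theorems.PhononStabilityCWC.FarControlStub

namespace Summit.AtomisticToContinuum.Crystallization.Theorems.PhononStabilityCWC.Cert

local notation "E3" => EuclideanSpace ℝ (Fin 3)

/-! ## Accumulated chain charges -/

/-- an accumulator entry `(T0, T1, T2)` -/
abbrev AccE := Mat × (Fin 3 → ℚ) × ℚ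

/-- a flat (fully evaluated) copy of a `3 × 3` rational matrix -/
def flatMat (f : Fin 3 → Fin 3 → ℚ) : Mat := ![![f 0 0, f 0 1, f 0 2], ![f 1 0, f 1 1, f 1 2], ![f 2 0, f 2 1, f 2 2]]

/-- a flat copy of a rational `3`-vector -/
def flatVec (f : Fin 3 → ℚ) : Fin 3 → ℚ := ![f 0, f 1, f 2]

/-- (chain bookkeeping) [folklore] -/
theorem flatMat_eq (f : Fin 3 → Fin 3 → ℚ) : flatMat f = f := by
  funext i j; fin_cases i <;> fin_cases j <;> rfl

/-- (chain bookkeeping) [folklore] -/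
theorem flatVec_eq (f : Fin 3 → ℚ) : flatVec f = f := by
  funext i; fin_cases i <;> rfl

/-- the weight of far class `c`: `a_c = −U(Q(c)) · |chain c|` -/
def accWeight (c : BondClass) : ℚ := -(uOfQ (Qint c) * (chainNNF c).length)

/-- add the contribution of (far class `c`, chain step at this entry) -/
def addE (c : BondClass) (e : AccE) : AccE :=
  let a := accWeight c
  let z := zhat0 c
  let s := sdiff c
  (flatMat fun i j => e.1 i j + a * (z i * z j), flatVec fun i => e.2.1 i + a * s * z i, e.2.2 + a * s ^ 2)

/-- bump the entry aligned with `s` (walking the class list and the table together) -/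
def bump (c s : BondClass) : List BondClass → List AccE → List AccE
  | [], _ => []
  | _ :: _, [] => []
  | n :: ns, e :: es => (if n = s then addE c e else e) :: bump c s ns es

/-- the zero table -/
def zeroTab : List AccE := nnList.map fun _ => ((fun _ _ => 0), (fun _ => 0), 0)

/-- **the accumulated chain table of the range `(qn, qf]`** (cell independent; computed once). -/
def chainAcc (qn qf : ℤ) : List AccE :=
  (classRange qn qf).foldl (fun tab c => (chainNNF c).foldl (fun tab s => bump c s nnList tab) tab) zeroTab

/-- the polynomial matrix of an accumulated entry: `T0 + T1 dᵀ + d T1ᵀ + T2 d dᵀ` with `d = d_c + x_D` -/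
def accLmatP (e : AccE) (C : CellData) : List (Mono × Mat) :=
  let T0 := e.1
  let T1 := e.2.1
  let T2 := e.2.2
  let u : Fin 3 → ℚ := fun i => T1 i + T2 * C.dc i
  [([], fun i j => T0 i j + T1 i * C.dc j + C.dc i * T1 j + T2 * (C.dc i * C.dc j)),
    ([7], fun i j => u i * e3 0 j + e3 0 i * u j), ([8], fun i j => u i * e3 1 j + e3 1 i * u j),
    ([9], fun i j => u i * e3 2 j + e3 2 i * u j),
    ([7, 7], fun i j => T2 * (e3 0 i * e3 0 j)), ([8, 8], fun i j => T2 * (e3 1 i * e3 1 j)),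
    ([9, 9], fun i j => T2 * (e3 2 i * e3 2 j)),
    ([7, 8], fun i j => T2 * (e3 0 i * e3 1 j + e3 1 i * e3 0 j)),
    ([7, 9], fun i j => T2 * (e3 0 i * e3 2 j + e3 2 i * e3 0 j)),
    ([8, 9], fun i j => T2 * (e3 1 i * e3 2 j + e3 2 i * e3 1 j))]

/-- the real quadratic matrix of an entry at shift `d` -/
def accQ (e : AccE) (d : Fin 3 → ℝ) : Fin 3 → Fin 3 → ℝ :=
  fun i j => (e.1 i j : ℝ) + e.2.1 i * d j + d i * e.2.1 j + e.2.2 * (d i * d j)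

/-- `accLmatP` evaluates to `accQ` at the chart assignment. [folklore] -/
theorem matVal_accLmatP (e : AccE) (C : CellData) (A B : E3 →L[ℝ] E3) (δ : E3) :
    matVal (chartX C A B δ) (accLmatP e C) = accQ e (contraOf δ) := by
  have e7 : chartX C A B δ 7 = contraOf δ 0 - C.dc 0 := by simp [chartX]
  have e8 : chartX C A B δ 8 = contraOf δ 1 - C.dc 1 := by simp [chartX]
  have e9 : chartX C A B δ 9 = contraOf δ 2 - C.dc 2 := by simp [chartX]
  funext i j
  simp only [matVal, accLmatP, accQ, monoVal, List.map_cons, List.map_nil, List.sum_cons, List.sum_nil,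
    List.prod_cons, List.prod_nil, e7, e8, e9, e3]
  fin_cases i <;> fin_cases j <;> simp <;> ring

/-- **the accumulated charge form of a cell** (24 class terms) -/
def chargeAccPPF (tab : List AccE) (C : CellData) : PolyPF :=
  (nnList.zip tab).flatMap fun p => classPPF p.1 (accLmatP p.2 C)

/-- the value of a table at shift `d`: `Σ_s P_s(accQ e_s d)` -/
def accVal (d : Fin 3 → ℝ) (w : Label → E3) (ns : List BondClass) (tab : List AccE) : ℝ :=
  ((ns.zip tab).map fun p => pairEvalR p.1 (accQ p.2 d) w).sum

/-- evaluation of the accumulated charge form. [folklore] -/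
theorem evalPPF_chargeAccPPF (tab : List AccE) (C : CellData) (A B : E3 →L[ℝ] E3) (δ : E3) {w : Label → E3}
    (hw : (support w).Finite) :
    evalPPF (chargeAccPPF tab C) (chartX C A B δ) w = accVal (contraOf δ) w nnList tab := by
  unfold chargeAccPPF accVal
  rw [evalPPF_flatMap]
  congr 1
  exact List.map_congr_left fun p _ => by rw [evalPPF_classPPF hw, matVal_accLmatP]

/-- the contribution of one (class, step): `a_c · P_s(ẑ_c(d) ẑ_c(d)ᵀ)`. [folklore] -/
theorem pairEvalR_accQ_addE {w : Label → E3} (hw : (support w).Finite) (c s : BondClass) (e : AccE) (d : Fin 3 → ℝ) :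
    pairEvalR s (accQ (addE c e) d) w =
      pairEvalR s (accQ e d) w + (accWeight c : ℝ) * pairEvalR s (fun i j => zhat c d i * zhat c d j) w := by
  rw [← pairEvalR_smul, ← pairEvalR_add hw]
  congr 1
  funext i j
  simp only [accQ, addE, flatMat_eq, flatVec_eq, zhat]
  push_cast
  ring

/-- bumping at a class absent from the list does nothing. [folklore] -/
theorem bump_of_not_mem (c s : BondClass) :
    ∀ (ns : List BondClass) (tab : List AccE), s ∉ ns → tab.length = ns.length → bump c s ns tab = tab := by
  intro ns
  induction ns with
  | nil => intro tab _ hlen; cases tab with | nil => rfl | cons _ _ => simp at hlen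
  | cons m ms ih =>
      intro tab hs hlen
      cases tab with
      | nil => rfl
      | cons f fs =>
          simp only [List.mem_cons, not_or] at hs
          simp only [List.length_cons, add_left_inj] at hlen
          simp only [bump, if_neg (Ne.symm hs.1), List.cons.injEq, true_and]
          exact ih fs hs.2 hlen

/-- `bump` preserves the length (of an aligned table). [folklore] -/
theorem length_bump (c s : BondClass) :
    ∀ (ns : List BondClass) (tab : List AccE), tab.length = ns.length → (bump c s ns tab).length = ns.length := by
  intro ns
  induction ns with
  | nil => intro tab hlen; cases tab with | nil => rfl | cons _ _ => simp at hlen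
  | cons n ns ih =>
      intro tab hlen
      cases tab with
      | nil => simp at hlen
      | cons e es =>
          simp only [List.length_cons, add_left_inj] at hlen
          simp [bump, ih es hlen]

/-- bumping a table adds exactly the contribution at `s` (class list without duplicates). [folklore] -/
theorem accVal_bump {w : Label → E3} (hw : (support w).Finite) (d : Fin 3 → ℝ) (c s : BondClass) :
    ∀ (ns : List BondClass) (tab : List AccE), ns.Nodup → tab.length = ns.length → s ∈ ns →
      accVal d w ns (bump c s ns tab) =
        accVal d w ns tab + (accWeight c : ℝ) * pairEvalR s (fun i j => zhat c d i * zhat c d j) w := by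
  intro ns
  induction ns with
  | nil => intro tab _ _ hs; simp at hs
  | cons n ns ih =>
      intro tab hnd hlen hs
      cases tab with
      | nil => simp at hlen
      | cons e es =>
          simp only [List.length_cons, add_left_inj] at hlen
          have hnd' : ns.Nodup := (List.nodup_cons.mp hnd).2
          have hn : n ∉ ns := (List.nodup_cons.mp hnd).1
          simp only [bump, accVal, List.zip_cons_cons, List.map_cons, List.sum_cons]
          by_cases hns : n = s
          · subst hns
            rw [if_pos rfl, pairEvalR_accQ_addE hw, bump_of_not_mem c n ns es hn hlen]
            ring
          · rw [if_neg hns]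
            have hs' : s ∈ ns := by
              rcases List.mem_cons.mp hs with h | h
              · exact absurd h.symm hns
              · exact h
            have := ih es hnd' hlen hs'
            unfold accVal at this
            rw [this]
            ring

/-- folding the steps of one chain. [folklore] -/
theorem accVal_foldl_chain {w : Label → E3} (hw : (support w).Finite) (d : Fin 3 → ℝ) (c : BondClass) :
    ∀ (ch : List BondClass) (tab : List AccE), tab.length = nnList.length → (∀ s ∈ ch, s ∈ nnList) →
      accVal d w nnList (ch.foldl (fun tab s => bump c s nnList tab) tab) =
        accVal d w nnList tab + (accWeight c : ℝ) * (ch.map fun s => pairEvalR s (fun i j => zhat c d i * zhat c d j) w).sum ∧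
      (ch.foldl (fun tab s => bump c s nnList tab) tab).length = nnList.length := by
  intro ch
  induction ch with
  | nil => intro tab hlen _; simp [hlen]
  | cons s rest ih =>
      intro tab hlen hmem
      rw [List.foldl_cons]
      have hs : s ∈ nnList := hmem s (List.mem_cons_self ..)
      have hlen' : (bump c s nnList tab).length = nnList.length := length_bump c s nnList tab hlen
      obtain ⟨h1, h2⟩ := ih (bump c s nnList tab) hlen' (fun t ht => hmem t (List.mem_cons_of_mem _ ht))
      refine ⟨?_, h2⟩
      rw [h1, accVal_bump hw d c s nnList tab nnList_nodup hlen hs, List.map_cons, List.sum_cons]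
      ring

/-- folding the far classes. [folklore] -/
theorem accVal_foldl_classes {w : Label → E3} (hw : (support w).Finite) (d : Fin 3 → ℝ) :
    ∀ (cs : List BondClass) (tab : List AccE), tab.length = nnList.length →
      accVal d w nnList (cs.foldl (fun tab c => (chainNNF c).foldl (fun tab s => bump c s nnList tab) tab) tab) =
        accVal d w nnList tab + (cs.map fun c => (accWeight c : ℝ) *
          ((chainNNF c).map fun s => pairEvalR s (fun i j => zhat c d i * zhat c d j) w).sum).sum ∧
      (cs.foldl (fun tab c => (chainNNF c).foldl (fun tab s => bump c s nnList tab) tab) tab).length = nnList.length := by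
  intro cs
  induction cs with
  | nil => intro tab hlen; simp [hlen]
  | cons c rest ih =>
      intro tab hlen
      rw [List.foldl_cons]
      have hmem : ∀ s ∈ chainNNF c, s ∈ nnList := by rw [chainNNF_eq_chainNN]; exact chainNN_sub_nnList c
      obtain ⟨h1, h2⟩ := accVal_foldl_chain hw d c (chainNNF c) tab hlen hmem
      obtain ⟨h3, h4⟩ := ih _ h2
      refine ⟨?_, h4⟩
      rw [h3, h1, List.map_cons, List.sum_cons]
      ring

/-- the zero table evaluates to zero. [folklore] -/
theorem accVal_zeroTab (d : Fin 3 → ℝ) (w : Label → E3) : accVal d w nnList zeroTab = 0 := by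
  unfold accVal zeroTab
  have h0 : ∀ p ∈ nnList.zip (nnList.map fun _ => (((fun _ _ => 0), (fun _ => 0), 0) : AccE)),
      pairEvalR p.1 (accQ p.2 d) w = 0 := by
    intro p hp
    have hp2 : p.2 = ((fun _ _ => 0), (fun _ => 0), 0) := by
      have := List.of_mem_zip hp
      obtain ⟨-, h⟩ := this
      rw [List.mem_map] at h
      obtain ⟨_, _, h⟩ := h
      exact h.symm
    have hq : accQ p.2 d = fun i j => (0 : ℝ) * (0 : ℝ) := by
      funext i j; simp [accQ, hp2]
    rw [hq, pairEvalR_smul, zero_mul]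
  rw [List.map_congr_left h0]
  simp

/-- **the accumulated table evaluates to the chain charges of `chargePPF`.** [folklore] -/
theorem accVal_chainAcc (qn qf : ℤ) (C : CellData) (A B : E3 →L[ℝ] E3) (δ : E3) {w : Label → E3}
    (hw : (support w).Finite) :
    accVal (contraOf δ) w nnList (chainAcc qn qf) = evalPPF (chargePPF C qn qf) (chartX C A B δ) w := by
  unfold chainAcc
  obtain ⟨h1, -⟩ := accVal_foldl_classes hw (contraOf δ) (classRange qn qf) zeroTab (by simp [zeroTab])
  rw [h1, accVal_zeroTab, zero_add, chargePPF, evalPPF_flatMap]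
  congr 1
  refine List.map_congr_left fun c _ => ?_
  rw [evalPPF_chargeTermPPF C A B δ c hw, matVal_LmatP, accWeight, chainNNF_eq_chainNN]
  push_cast
  ring

/-! ## A strict (function-free) accumulator for the native computation

The entries of `chainAcc` are built with `![…]` (closures): evaluating them natively re-runs the accumulation
history.  `AccR` carries the same thirteen rationals as plain fields; `chainAccR` is the same fold and
`chainAccR_map_toE` identifies the two, so the native identity check is done on `AccR` data. -/

/-- thirteen rationals: `T0` (row major), `T1`, `T2` -/
structure AccR where
  /-- `T0 0 0` -/ t00 : ℚ
  /-- `T0 0 1` -/ t01 : ℚ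
  /-- `T0 0 2` -/ t02 : ℚ
  /-- `T0 1 0` -/ t10 : ℚ
  /-- `T0 1 1` -/ t11 : ℚ
  /-- `T0 1 2` -/ t12 : ℚ
  /-- `T0 2 0` -/ t20 : ℚ
  /-- `T0 2 1` -/ t21 : ℚ
  /-- `T0 2 2` -/ t22 : ℚ
  /-- `T1 0` -/ u0 : ℚ
  /-- `T1 1` -/ u1 : ℚ
  /-- `T1 2` -/ u2 : ℚ
  /-- `T2` -/ w : ℚ
  deriving DecidableEq

namespace AccR
/-- the matrix part -/
def mat (r : AccR) : Mat := ![![r.t00, r.t01, r.t02], ![r.t10, r.t11, r.t12], ![r.t20, r.t21, r.t22]]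
/-- the vector part -/
def vec (r : AccR) : Fin 3 → ℚ := ![r.u0, r.u1, r.u2]
/-- as an accumulator entry -/
def toE (r : AccR) : AccE := (r.mat, r.vec, r.w)
end AccR

/-- the zero entry -/
def zeroR : AccR := ⟨0, 0, 0, 0, 0, 0, 0, 0, 0, 0, 0, 0, 0⟩

/-- strict version of `addE` -/
def addR (c : BondClass) (r : AccR) : AccR :=
  let a := accWeight c
  let z0 := zhat0 c 0
  let z1 := zhat0 c 1
  let z2 := zhat0 c 2
  let s := sdiff c
  { t00 := r.t00 + a * (z0 * z0), t01 := r.t01 + a * (z0 * z1), t02 := r.t02 + a * (z0 * z2),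
    t10 := r.t10 + a * (z1 * z0), t11 := r.t11 + a * (z1 * z1), t12 := r.t12 + a * (z1 * z2),
    t20 := r.t20 + a * (z2 * z0), t21 := r.t21 + a * (z2 * z1), t22 := r.t22 + a * (z2 * z2),
    u0 := r.u0 + a * s * z0, u1 := r.u1 + a * s * z1, u2 := r.u2 + a * s * z2, w := r.w + a * s ^ 2 }

/-- strict version of `bump` -/
def bumpR (c s : BondClass) : List BondClass → List AccR → List AccR
  | [], _ => []
  | _ :: _, [] => []
  | n :: ns, e :: es => (if n = s then addR c e else e) :: bumpR c s ns es

/-- **the strict accumulated chain table** (this is what is computed natively) -/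
def chainAccR (qn qf : ℤ) : List AccR :=
  (classRange qn qf).foldl (fun tab c => (chainNNF c).foldl (fun tab s => bumpR c s nnList tab) tab) (nnList.map fun _ => zeroR)

/-- `addR` is `addE` on the entries. [folklore] -/
theorem toE_addR (c : BondClass) (r : AccR) : (addR c r).toE = addE c r.toE := by
  unfold addR addE AccR.toE
  simp only [flatMat_eq, flatVec_eq, Prod.mk.injEq]
  refine ⟨?_, ?_, by trivial⟩
  · funext i j; fin_cases i <;> fin_cases j <;> rfl
  · funext i; fin_cases i <;> rfl

/-- `bumpR` is `bump` on the entries. [folklore] -/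
theorem map_toE_bumpR (c s : BondClass) :
    ∀ (ns : List BondClass) (tab : List AccR), (bumpR c s ns tab).map AccR.toE = bump c s ns (tab.map AccR.toE)
  | [], [] => rfl
  | [], _ :: _ => rfl
  | _ :: _, [] => rfl
  | n :: ns, e :: es => by
      simp only [bumpR, bump, List.map_cons, map_toE_bumpR c s ns es]
      split_ifs <;> simp [toE_addR]

/-- folding one chain, strict vs functional. [folklore] -/
theorem map_toE_foldl_chain (c : BondClass) :
    ∀ (ch : List BondClass) (tab : List AccR),
      (ch.foldl (fun tab s => bumpR c s nnList tab) tab).map AccR.toE =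
        ch.foldl (fun tab s => bump c s nnList tab) (tab.map AccR.toE) := by
  intro ch
  induction ch with
  | nil => intro tab; rfl
  | cons s rest ih => intro tab; rw [List.foldl_cons, List.foldl_cons, ih, map_toE_bumpR]

/-- folding the classes, strict vs functional. [folklore] -/
theorem map_toE_foldl_classes :
    ∀ (cs : List BondClass) (tab : List AccR),
      (cs.foldl (fun tab c => (chainNNF c).foldl (fun tab s => bumpR c s nnList tab) tab) tab).map AccR.toE =
        cs.foldl (fun tab c => (chainNNF c).foldl (fun tab s => bump c s nnList tab) tab) (tab.map AccR.toE) := by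
  intro cs
  induction cs with
  | nil => intro tab; rfl
  | cons c rest ih => intro tab; rw [List.foldl_cons, List.foldl_cons, ih, map_toE_foldl_chain]

/-- **the strict table is the table.** [folklore] -/
theorem chainAccR_map_toE (qn qf : ℤ) : (chainAccR qn qf).map AccR.toE = chainAcc qn qf := by
  unfold chainAccR chainAcc
  rw [map_toE_foldl_classes, List.map_map]
  congr 1
  unfold zeroTab
  refine List.map_congr_left fun _ _ => ?_
  simp only [Function.comp_apply, AccR.toE, zeroR, AccR.mat, AccR.vec, Prod.mk.injEq]
  refine ⟨?_, ?_, trivial⟩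
  · funext i j; fin_cases i <;> fin_cases j <;> rfl
  · funext i; fin_cases i <;> rfl

/-- the table hypothesis of `chargeAcc_le` from the NATIVE identity on strict data. [folklore] -/
theorem tab_eq_of_strict {qn qf : ℤ} {lit : List AccR} (h : lit = chainAccR qn qf) :
    lit.map AccR.toE = chainAcc qn qf := by
  rw [h, chainAccR_map_toE]

/-- **validity of the accumulated chain charges:** for the literal table of the range,
`evalPPF (chargeAccPPF tab C) ≤ −chargeSum Rn Rf chainNN A δ w`. [folklore] -/
theorem chargeAcc_le (hC : ChainBound) {Rn Rf : ℝ} {bn bf : ℕ} {qn qf : ℤ} (hbn : ⌈2 * Rn⌉₊ + 1 = bn)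
    (hqn : ((qn : ℤ) : ℝ) = 36 * Rn ^ 2) (hbf : ⌈2 * Rf⌉₊ + 1 = bf) (hqf : ((qf : ℤ) : ℝ) = 36 * Rf ^ 2)
    (hRn : 2 ≤ Rn) (hRf : 0 ≤ Rf) (hvalid : ValidChains Rn Rf chainNN) {tab : List AccE} (htab : tab = chainAcc qn qf)
    (C : CellData) {A B : E3 →L[ℝ] E3} {δ : E3} (hW : CellWindow A) (hδ : ShiftWindow A δ)
    {w : Label → E3} (hw : (support w).Finite) :
    evalPPF (chargeAccPPF tab C) (chartX C A B δ) w ≤ -chargeSum Rn Rf chainNN A δ w := by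
  rw [evalPPF_chargeAccPPF tab C A B δ hw, htab, accVal_chainAcc qn qf C A B δ hw]
  exact charge_le hC hbn hqn hbf hqf hRn hRf hvalid (chainsNN_eq_true qn qf) C hW hδ hw

/-- Anchor of this support file (registered stub of the line skeleton, lead c2). -/
theorem stub_certChainAcc : ∀ (c s : BondClass) (ns : List BondClass) (tab : List AccE), s ∉ ns → tab.length = ns.length → bump c s ns tab = tab :=
  fun c s ns tab h1 h2 => bump_of_not_mem c s ns tab h1 h2

end Summit.AtomisticToContinuum.Crystallization.Theorems.PhononStabilityCWC.Cert

end
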